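import Mathlib
import Summits.RiemannHypothesis.RiemannHypothesis.Theses.WeilGroundState
import Summits.RiemannHypothesis.RiemannHypothesis.Theorems.WeilGroundStateGroundStateSimpleEvenCellTransfer
import Summits.RiemannHypothesis.RiemannHypothesis.Theorems.WeilGroundStateGroundStateSimpleEvenOfOddSectorGap
import Summits.RiemannHypothesis.RiemannHypothesis.Theorems.WeilGroundStateGroundStateSimpleEvenArch
import Summits.RiemannHypothesis.RiemannHypothesis.Theorems.WeilGroundStateGroundStateSimpleEvenTrialUpperA
import Summits.RiemannHypothesis.RiemannHypothesis.Theorems.WeilGroundStateGroundStateSimpleEvenTrialUpperB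
import Summits.RiemannHypothesis.RiemannHypothesis.Theorems.WeilGroundStateGroundStateSimpleEvenTrialUpperC
import Summits.RiemannHypothesis.RiemannHypothesis.Theorems.WeilGroundStateGroundStateSimpleEvenTrialUpperD
import Summits.RiemannHypothesis.RiemannHypothesis.Theorems.WeilGroundStateGroundStateSimpleEvenOddLowerA
import Summits.RiemannHypothesis.RiemannHypothesis.Theorems.WeilGroundStateGroundStateSimpleEvenOddLowerB
import Summits.RiemannHypothesis.RiemannHypothesis.Theorems.WeilGroundStateGroundStateSimpleEvenOddLowerC
import Summits.RiemannHypothesis.RiemannHypothesis.Theorems.WeilGroundStateGroundStateSimpleEvenOddLowerD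
import HarnessLib

/-!
# Crux `GroundStateSimpleEven` (stmt-RiemannHypothesis-1526), line `parity-multiplicity-commutator` (v5):
# the Connes–van Suijlekom hypothesis on EVERY window up to the second prime

Support file (`--supports stmt-RiemannHypothesis-1526`) proving the registered sub-goal
`stub_firstPrimeWindows`: for every first-prime window `(log 2)/2 < a ≤ (log 3)/2` the bottom of the
windowed Weil form is simple, isolated and EVEN (`WeilWindowSimpleEven a`) — RH-free.  Together with
the archimedean windows (`stub_archimedeanWindows`, p145580, every `0 < a ≤ (log 2)/2`) this gives the
hypothesis of Connes–van Suijlekom [CMP 2025, Thm 6.1] — the first of the two missing steps named by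
Connes (arXiv:2602.04022 §6.6) and Connes–Consani–Moscovici (arXiv:2511.22755 §8) — on the whole range
`0 < a ≤ (log 3)/2` (`weilWindowSimpleEven_of_le_log_three_half`), a 55-fold extension of Suzuki's
`a ≤ 1/100` (arXiv:2606.09096 Thm 1.4) by a different method, now through the first prime.

## Proof (four cells of the landed cell transfer `weilWindowSimpleEven_on_cell_of_le`)

On a cell `[b, c]` it suffices to have `ε(b) ≤ U < L ≤ Re Q(g)` for every normalised ODD window-`c` test
function (both sector bottoms are antitone in the window; ORDER ⟹ simple-even by the halving theorem of
this line, p136723).  Cells and certified constants: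

| cell | `U` (Rayleigh–Ritz, Markov form) | `L` (odd-sector margin certificate) |
|---|---|---|
| `[11/32, 2/5]`  | `ε(11/32) ≤ 53/10000` (`stub_trialUpperA`) | `Re Q ≥ 1/100` at `2/5` (`stub_oddLowerA`, cert. A, `κ−κ' = 1.09e-2`) |
| `[2/5, 23/50]`  | `ε(2/5) ≤ 3/10000` (`stub_trialUpperB`)    | `Re Q ≥ 1/1000` at `23/50` (cert. B, `1.05e-3`) |
| `[23/50, 51/100]` | `ε(23/50) ≤ 15/1000000` (`stub_trialUpperC`) | `Re Q ≥ 6/100000` at `51/100` (cert. C, `6.60e-5`) |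
| `[51/100, (log 3)/2]` | `ε(51/100) ≤ 17/5000000` (`stub_trialUpperD`) | `Re Q ≥ 6/1000000` at `(log 3)/2` (cert. D, a₀ = 563/1024, `6.49e-6`) |

The `U`'s are exact rational evaluations of the Markov form `Re Q = P + 𝓔_b − M_b‖·‖²` on windowed even
polynomials (form-domain Rayleigh bound); the `L`'s come from the kernel-checked moment-method certificates
`weilCertOddA–D` (`Literature/NumberTheory/LFunctions/WeilFirstPrimeOddMargin*.lean`: the Stage-C first-prime
format restricted to the odd block with a lowered Bessel coefficient) through the odd-margin soundness
theorem `stub_oddMarginSound`.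
-/

noncomputable section

open Set MeasureTheory Filter

open Literature.NumberTheory.LFunctions
open Summit.RiemannHypothesis.RiemannHypothesis.Theses.WeilGroundState

namespace Summit.RiemannHypothesis.RiemannHypothesis.Theorems

set_option linter.dupNamespace false in
/-- **Registered sub-goal (FPW) of line `parity-multiplicity-commutator` (v5): the crux on every
first-prime window.** For `(log 2)/2 < a ≤ (log 3)/2`, `WeilWindowSimpleEven a` (four cells of the cell
transfer, fed by `stub_trialUpperA–D` and `stub_oddLowerA–D`). [folklore] -/
theorem stub_firstPrimeWindows :
    ∀ a : ℝ, Real.log 2 / 2 < a → a ≤ Real.log 3 / 2 → WeilWindowSimpleEven a := by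
  intro a hlo hhi
  have hl2 := Real.log_two_gt_d9
  rcases le_or_gt a (2 / 5) with h1 | h1
  · exact GroundStateSimpleEven.weilWindowSimpleEven_on_cell_of_le
      (b := 11 / 32) (c := 2 / 5) (U := 53 / 10000) (L := 1 / 100) (by norm_num) (by norm_num)
      stub_trialUpperA (fun g hg hs hn ho ↦ stub_oddLowerA g hg hs hn ho) (by linarith) h1
  rcases le_or_gt a (23 / 50) with h2 | h2
  · exact GroundStateSimpleEven.weilWindowSimpleEven_on_cell_of_le
      (b := 2 / 5) (c := 23 / 50) (U := 3 / 10000) (L := 1 / 1000) (by norm_num) (by norm_num)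
      stub_trialUpperB (fun g hg hs hn ho ↦ stub_oddLowerB g hg hs hn ho) h1.le h2
  rcases le_or_gt a (51 / 100) with h3 | h3
  · exact GroundStateSimpleEven.weilWindowSimpleEven_on_cell_of_le
      (b := 23 / 50) (c := 51 / 100) (U := 15 / 1000000) (L := 6 / 100000) (by norm_num) (by norm_num)
      stub_trialUpperC (fun g hg hs hn ho ↦ stub_oddLowerC g hg hs hn ho) h2.le h3
  · exact GroundStateSimpleEven.weilWindowSimpleEven_on_cell_of_le
      (b := 51 / 100) (c := Real.log 3 / 2) (U := 17 / 5000000) (L := 6 / 1000000) (by norm_num)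
      (by norm_num) stub_trialUpperD (fun g hg hs hn ho ↦ stub_oddLowerD g hg hs hn ho) h3.le hhi

set_option linter.dupNamespace false in
/-- **The Connes–van Suijlekom hypothesis on every window up to the second prime (RH-free).** For every
`0 < a ≤ (log 3)/2` the bottom of Weil's quadratic form on test functions supported in `[-a, a]` is a
simple, isolated eigenvalue with EVEN eigenfunction (`WeilWindowSimpleEven a`): the archimedean windows
`a ≤ (log 2)/2` (`stub_archimedeanWindows`, Fourier bathtub vs. parabola) and the first-prime windows
(`stub_firstPrimeWindows`, odd-margin certificates vs. Rayleigh–Ritz). [folklore] -/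
theorem weilWindowSimpleEven_of_le_log_three_half :
    ∀ a : ℝ, 0 < a → a ≤ Real.log 3 / 2 → WeilWindowSimpleEven a := by
  intro a ha hhi
  rcases le_or_gt a (Real.log 2 / 2) with hle | hlt
  · exact stub_archimedeanWindows a ha hle
  · exact stub_firstPrimeWindows a hlt hhi

set_option linter.dupNamespace false in
/-- **ORDER on every window up to the second prime**: for `0 < a ≤ (log 3)/2` the odd sector is gapped
above the bottom `ε(a)` (`weilWindowSimpleEven_iff_oddSectorGap`, "parity decides", p136723). [folklore] -/
theorem oddSectorGap_of_le_log_three_half :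
    ∀ a : ℝ, 0 < a → a ≤ Real.log 3 / 2 → ∃ δ : ℝ, 0 < δ ∧ ∀ g : ℝ → ℂ, IsWeilTest g →
      tsupport g ⊆ Icc (-a) a → ∫ t, ‖g t‖ ^ 2 = (1 : ℝ) → (∀ t, g (-t) = -g t) →
        weilGroundEnergy a + δ ≤ (weilQuadratic g).re :=
  fun a ha hhi ↦ (GroundStateSimpleEven.weilWindowSimpleEven_iff_oddSectorGap ha).1
    (weilWindowSimpleEven_of_le_log_three_half a ha hhi)

set_option linter.dupNamespace false in
/-- **Every ground state at a window `a ≤ (log 3)/2` is a.e. even** ("evenness decides",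
`weilWindowSimpleEven_iff_groundStates_ae_even`, p136723). [folklore] -/
theorem groundStates_ae_even_of_le_log_three_half :
    ∀ a : ℝ, 0 < a → a ≤ Real.log 3 / 2 → ∀ u : ℝ → ℂ, IsWeilGroundState a u →
      u =ᵐ[volume] fun t ↦ u (-t) :=
  fun a ha hhi ↦ (GroundStateSimpleEven.weilWindowSimpleEven_iff_groundStates_ae_even ha).1
    (weilWindowSimpleEven_of_le_log_three_half a ha hhi)

end Summit.RiemannHypothesis.RiemannHypothesis.Theorems
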